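import Literature.Topology.FourManifolds.HomotopySpheresSumDimTwo
import Literature.Topology.FourManifolds.SmoothOrientationProofs
import Literature.Topology.FourManifolds.SmoothPoincareTwoMorse
import Literature.Topology.FourManifolds.SPC4HandlesSelfIndexingProofs
import Literature.AlgebraicTopology.SingularHomology.HurewiczVanishingProofs
import Literature.Topology.FourManifolds.HCobordismLevelIsotopy
import Literature.Topology.FourManifolds.HCobordismAlignedChartsProof
import Literature.Topology.FourManifolds.HCobordismGlueChartsProof
import HarnessLib

/-!
# Punctured homotopy spheres are contractible: the trust base after the Morse–Reeb route

Topic `Literature/Topology/FourManifolds` (fact seat of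
`Literature.Topology.FourManifolds.HomotopySphere.contractibleSpace_compl_image_ball`,
Kosinski, *Differential Manifolds* (1993), Ch. VI §1; Kervaire–Milnor, *Groups of homotopy
spheres I* (1963), p. 507).

After `HomotopySpheresSumENR.lean` (dimensions `n ≥ 3` from the vanishing form of the Hurewicz
theorem), `HomotopyTwoSphereNoSaddle.lean` (no saddles on oriented simply connected closed
surfaces) and `HomotopySpheresSumDimTwo.lean` (dimension `2` by Reeb's flow argument) two
leaves were left: the Hurewicz theorem and, in dimension `2`, the cancellation of a superfluous
minimum.  Meanwhile the tree PROVED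

* the vanishing form of the Hurewicz theorem,
  `Literature.AlgebraicTopology.SingularHomology.hurewicz_subsingleton_holds`
  (`HurewiczVanishingProofs.lean`; Hatcher 2002, Thm. 4.32, by Spanier's chain-level argument);
* that simply connected manifolds are orientable,
  `Literature.Topology.FourManifolds.isOrientable_of_simplyConnectedSpace_holds`
  (`SmoothOrientationProofs.lean`; Lee 2013, Thm. 15.43);
* Milnor's final rearrangement theorem and the bridging pair, reducing Matsumoto's Thm. 3.35
  (`exists_isMorse_ncard_criticalSetOfIndex_eq_one n`: one minimum, one maximum) and spc4.S24 (b)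
  (`exists_isMorse_isSelfIndexing n`) to the First Cancellation Theorem on a slab
  (`Cobordism.Milnor1965_firstCancellation_slab`, Milnor 1965, Thm. 5.4) and further to
  Assertion 6 of its proof (`Cobordism.Milnor1965_cancellation_modelChart`)
  (`SPC4HandlesSelfIndexingProofs.lean`).

This file records the resulting implications, all **proved**:

* `criticalSetOfIndex_one_eq_empty_of_simplyConnected` — **no saddles on simply connected
  closed surfaces**, in the shape of the hypothesis `hsc` of
  `nonemptyDiffeomorphSphere_two_of_simplyConnected` (`SmoothPoincareTwoMorse.lean`): on a
  compact Hausdorff simply connected smooth surface a Morse function with one critical point of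
  index `0` and one of index `2` has none of index `1` (orientation supplied by
  `isOrientable_of_simplyConnectedSpace_holds`, then `criticalSetOfIndex_one_eq_empty`);
* `nonemptyDiffeomorphSphere_two_of_niceMorse` — **`Θ₂ = 0`** (every smooth surface homotopy
  equivalent to `S²` is diffeomorphic to `S²`, the fact `nonemptyDiffeomorphSphere_two`) from
  Matsumoto's Thm. 3.35 in dimension `2` alone; hence from spc4.S24 (b) in dimension `2`
  (`…_of_exists_isSelfIndexing`), from Milnor's Thm. 5.4 on a slab
  (`…_of_firstCancellation_slab`) or from Assertion 6 (`…_of_modelChart`);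
* `HomotopySphere.contractibleSpace_compl_image_ball_of_niceMorse` — the target fact (all `n`)
  from Matsumoto's Thm. 3.35 in dimension `2` alone (Reeb route of `HomotopySpheresSumDimTwo.lean`,
  Hurewicz leaf discharged), and the same from the cancellation step
  (`…_of_cancel`), from spc4.S24 (b) (`…_of_exists_isSelfIndexing`), from Thm. 5.4 on a slab
  (`…_of_firstCancellation_slab`), from Assertion 6 (`…_of_modelChart`), and from `Θ₂ = 0`
  (`…_of_sphere_two`, the single remaining leaf of `contractibleSpace_compl_image_ball_of_hurewicz_of_two`);
* `HomotopySphere.nonempty_homotopyEquiv_sphere_of_isConnectedSum_of_niceMorse` — the sum of two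
  homotopy spheres is a homotopy sphere (Kervaire–Milnor 1963, §2), from the same single leaf.

So the trust base of `HomotopySphere.contractibleSpace_compl_image_ball` is now ONE statement of
Morse theory on closed surfaces — any of: Matsumoto's Thm. 3.35 for `m = 2`, spc4.S24 (b) for
`n = 2`, Milnor's Thm. 5.4 on a slab, or Assertion 6 of its proof.

**Update (the deformation leaf).**  The tree has since proved two of the three parts of
Assertion 6 (`Cobordism.Milnor1965_cancellation_alignedCharts_holds`,
`Cobordism.Milnor1965_cancellation_glueCharts_holds`) and reduced the third, the general case
`Cobordism.Milnor1965_cancellation_levelIsotopy`, to the deformation of the level diffeomorphism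
`h` by the local Theorem 5.6 (`Cobordism.Milnor1965_cancellation_levelDeformation`,
`Cobordism.Milnor1965_cancellation_levelIsotopy_of_deformation`, `HCobordismLevelIsotopy.lean`).
Accordingly this file also records, **proved**:

* `HomotopySphere.contractibleSpace_compl_image_ball_of_levelIsotopy` — the target fact from the
  general case of Assertion 6 alone;
* `HomotopySphere.contractibleSpace_compl_image_ball_of_levelDeformation` — the target fact from
  the deformation of `h` alone (Milnor 1965, PDF pp. 31–32 with Thm. 5.6), now the single
  remaining leaf: `contractibleSpace_compl_image_ball_holds` is this theorem applied to
  `Cobordism.Milnor1965_cancellation_levelDeformation_holds` once that lands.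

## References

* A. Kosinski, *Differential Manifolds*, Academic Press (1993), Ch. VI §1. [Kosinski1993]
* M. Kervaire, J. Milnor, *Groups of homotopy spheres I*, Ann. of Math. 77 (1963), §2,
  pp. 505–507. [KervaireMilnorAnnals1963]
* Y. Matsumoto, *An Introduction to Morse Theory*, Transl. Math. Monogr. 208, AMS (2001),
  Thm. 3.35 and its proof (pp. 119–120), §1.5(b). [Matsumoto2001]
* J. Milnor, *Lectures on the h-cobordism theorem*, Princeton (1965), Thm. 5.4 and its proof,
  Assertion 6 (PDF pp. 30–32), Thm. 5.6 (PDF p. 32). [MilnorHCobordism1965]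
* J. M. Lee, *Introduction to Smooth Manifolds*, 2nd ed. (2013), Thm. 15.43. [LeeSmoothManifolds2013]
* A. Hatcher, *Algebraic Topology* (2002), Thm. 4.32. [HatcherAT2002]
-/

noncomputable section

open scoped Manifold ContDiff Topology
open Set Function Metric Module

namespace Literature.Topology.FourManifolds

/-! ### No saddles on simply connected closed surfaces -/

/-- **No saddles on simply connected closed surfaces** (the hypothesis `hsc` of
`nonemptyDiffeomorphSphere_two_of_simplyConnected`, now a theorem): on a compact Hausdorff
simply connected smooth surface, a Morse function with exactly one critical point of index `0`
and exactly one of index `2` has no critical point of index `1`.  A simply connected manifold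
is connected and orientable (`isOrientable_of_simplyConnectedSpace_holds`, Lee 2013,
Thm. 15.43), and on an oriented simply connected closed surface a lowest saddle would
disconnect a regular level, contradicting simple connectivity
(`criticalSetOfIndex_one_eq_empty`, Matsumoto 2001, §1.5(b) and proof of Thm. 3.35). [cite: Matsumoto2001, §1.5(b) (pp. 26–29) and Thm. 3.35] [cite: LeeSmoothManifolds2013, Thm. 15.43] -/
theorem criticalSetOfIndex_one_eq_empty_of_simplyConnected (M : Type*) [TopologicalSpace M]
    [T2Space M] [CompactSpace M] [SimplyConnectedSpace M]
    [ChartedSpace (EuclideanSpace ℝ (Fin 2)) M] [IsManifold (𝓡 2) ∞ M] {f : M → ℝ}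
    (hf : IsMorse (𝓡 2) f) (h0 : (criticalSetOfIndex (𝓡 2) f 0).ncard = 1)
    (h2 : (criticalSetOfIndex (𝓡 2) f 2).ncard = 1) : criticalSetOfIndex (𝓡 2) f 1 = ∅ := by
  obtain ⟨o⟩ := isOrientable_of_simplyConnectedSpace_holds (I := 𝓡 2) (M := M)
  obtain ⟨pbot, hbot⟩ := Set.ncard_eq_one.1 h0
  obtain ⟨ptop, htop⟩ := Set.ncard_eq_one.1 h2
  exact criticalSetOfIndex_one_eq_empty o hf hbot htop

/-! ### `Θ₂ = 0` from Morse theory on surfaces -/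

/-- **`Θ₂ = 0` from Matsumoto's Thm. 3.35 in dimension `2` alone**: if every closed connected
surface carries a Morse function with one critical point of index `0` and one of index `2`
(`exists_isMorse_ncard_criticalSetOfIndex_eq_one 2`), then every Hausdorff second countable
smooth surface homotopy equivalent to `S²` is diffeomorphic to `S²`
(`nonemptyDiffeomorphSphere_two`; Kervaire–Milnor 1963, p. 507: "`Θ₁ = Θ₂ = 0`"):
`nonemptyDiffeomorphSphere_two_of_simplyConnected` with its no-saddle hypothesis discharged by
`criticalSetOfIndex_one_eq_empty_of_simplyConnected`. [cite: KervaireMilnorAnnals1963, §2 p. 507] [cite: Matsumoto2001, Thm. 3.35, Thm. 1.16] -/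
theorem nonemptyDiffeomorphSphere_two_of_niceMorse
    (hU : exists_isMorse_ncard_criticalSetOfIndex_eq_one.{0} 2) :
    nonemptyDiffeomorphSphere_two.{0} :=
  nonemptyDiffeomorphSphere_two_of_simplyConnected hU
    fun M _ _ _ _ _ _ _ _ hf h0 h2 => criticalSetOfIndex_one_eq_empty_of_simplyConnected M hf h0 h2

/-- **`Θ₂ = 0` from spc4.S24 (b) in dimension `2`** (a closed connected surface carries a
self-indexing Morse function with one critical point of index `0` and one of index `2`,
`exists_isMorse_isSelfIndexing 2`; Milnor 1965, Thm. 4.8 with §8). [cite: KervaireMilnorAnnals1963, §2 p. 507] [cite: MilnorHCobordism1965, Thm. 4.8 and §8] -/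
theorem nonemptyDiffeomorphSphere_two_of_exists_isSelfIndexing
    (hS : FourManifolds.exists_isMorse_isSelfIndexing.{0} 2) : nonemptyDiffeomorphSphere_two.{0} :=
  nonemptyDiffeomorphSphere_two_of_niceMorse (exists_isMorse_ncard_criticalSetOfIndex_eq_one_of_SPC4 2 hS)

/-- **`Θ₂ = 0` from Milnor's First Cancellation Theorem 5.4 on a slab**
(`Cobordism.Milnor1965_firstCancellation_slab`), everything else on the way being proved in the
tree (`exists_isMorse_isSelfIndexing_of_firstCancellation_slab`). [cite: KervaireMilnorAnnals1963, §2 p. 507] [cite: MilnorHCobordism1965, Thm. 5.4] -/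
theorem nonemptyDiffeomorphSphere_two_of_firstCancellation_slab
    (h54 : Cobordism.Milnor1965_firstCancellation_slab.{0}) : nonemptyDiffeomorphSphere_two.{0} :=
  nonemptyDiffeomorphSphere_two_of_exists_isSelfIndexing
    (exists_isMorse_isSelfIndexing_of_firstCancellation_slab h54 2)

/-- **`Θ₂ = 0` from Assertion 6 of the proof of Milnor's Thm. 5.4**
(`Cobordism.Milnor1965_cancellation_modelChart`, the chart carrying the model field to the
gradient-like field near the connecting trajectory), by
`exists_isMorse_isSelfIndexing_of_modelChart`. [cite: KervaireMilnorAnnals1963, §2 p. 507] [cite: MilnorHCobordism1965, proof of Thm. 5.4, Assertion 6] -/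
theorem nonemptyDiffeomorphSphere_two_of_modelChart
    (hE : Cobordism.Milnor1965_cancellation_modelChart.{0}) : nonemptyDiffeomorphSphere_two.{0} :=
  nonemptyDiffeomorphSphere_two_of_exists_isSelfIndexing (exists_isMorse_isSelfIndexing_of_modelChart hE 2)

/-! ### The target fact from one leaf -/

namespace HomotopySphere

/-- **A punctured homotopy `2`-sphere is contractible**, GIVEN Matsumoto's Thm. 3.35 in
dimension `2` (`exists_isMorse_ncard_criticalSetOfIndex_eq_one 2`): the Morse function with one
minimum and one maximum has no saddle (`criticalSetOfIndex_one_eq_empty`, the homotopy sphere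
being oriented and simply connected), so Reeb's flow argument applies
(`contractibleSpace_compl_singleton_of_two_critical`). [cite: Kosinski1993, Ch. VI §1 (remark before Cor. 1.4)] [cite: Matsumoto2001, Thm. 3.35 and Thm. 3.6] -/
theorem contractibleSpace_compl_singleton_two_of_niceMorse
    (hU : exists_isMorse_ncard_criticalSetOfIndex_eq_one.{0} 2) (S : HomotopySphere 2)
    (p : S.carrier) : ContractibleSpace ↥(({p}ᶜ : Set S.carrier)) := by
  haveI := S.simplyConnectedSpace le_rfl
  haveI : ConnectedSpace S.carrier := inferInstance
  obtain ⟨f, hfM, h0, h2⟩ := hU S.carrier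
  obtain ⟨pbot, hbot⟩ := Set.ncard_eq_one.1 h0
  obtain ⟨ptop, htop⟩ := Set.ncard_eq_one.1 h2
  exact contractibleSpace_compl_singleton_of_two_critical hfM hbot htop
    (criticalSetOfIndex_one_eq_empty S.orientation hfM hbot htop) p

/-- **`contractibleSpace_compl_image_ball` in dimension `2`**, GIVEN Matsumoto's Thm. 3.35 in
dimension `2`: a homotopy `2`-sphere with an open disc removed is contractible
(`BallComplement.homotopyEquiv` with the punctured case). [cite: Kosinski1993, Ch. VI §1 (remark before Cor. 1.4)] -/
theorem contractibleSpace_compl_image_ball_two_of_niceMorse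
    (hU : exists_isMorse_ncard_criticalSetOfIndex_eq_one.{0} 2) (S : HomotopySphere 2)
    {i : EuclideanSpace ℝ (Fin 2) → S.carrier}
    (hi : Manifold.IsSmoothEmbedding 𝓘(ℝ, EuclideanSpace ℝ (Fin 2)) (𝓡 2) ∞ i) :
    ContractibleSpace ↥((i '' ball (0 : EuclideanSpace ℝ (Fin 2)) 1)ᶜ) :=
  haveI := contractibleSpace_compl_singleton_two_of_niceMorse hU S (i 0)
  (Literature.AlgebraicTopology.Homotopy.BallComplement.homotopyEquiv
    (isOpenEmbedding_of_isSmoothEmbedding_euclidean hi)).contractibleSpace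

/-- **Punctured homotopy spheres are contractible (all `n`) from ONE leaf, Matsumoto's
Thm. 3.35 in dimension `2`**: dimensions `0`, `1` are theorems of the tree, dimension `2` is the
Morse–Reeb route (`contractibleSpace_compl_image_ball_two_of_niceMorse`), and dimensions
`n ≥ 3` the Whitehead–Hurewicz route (`contractibleSpace_compl_image_ball_of_hurewicz_of_le`)
with the Hurewicz theorem now PROVED (`hurewicz_subsingleton_holds`). [cite: Kosinski1993, Ch. VI §1 (remark before Cor. 1.4)] [cite: KervaireMilnorAnnals1963, Lemma 2.4, proof (p. 507)] -/
theorem contractibleSpace_compl_image_ball_of_niceMorse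
    (hU : exists_isMorse_ncard_criticalSetOfIndex_eq_one.{0} 2) :
    contractibleSpace_compl_image_ball := by
  intro n S i hi
  rcases Nat.lt_or_ge n 3 with hn | hn
  · interval_cases n
    · exact S.contractibleSpace_compl_image_ball_zero i
    · exact S.contractibleSpace_compl_image_ball_one hi
    · exact contractibleSpace_compl_image_ball_two_of_niceMorse hU S hi
  · exact contractibleSpace_compl_image_ball_of_hurewicz_of_le
      Literature.AlgebraicTopology.SingularHomology.hurewicz_subsingleton_holds hn S hi

/-- **The target fact from the cancellation step in dimension `2`**
(`exists_isMorse_ncard_criticalSetOfIndex_zero_add_one_eq 2`, Matsumoto 2001, proof of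
Thm. 3.35), the Hurewicz leaf of `contractibleSpace_compl_image_ball_of_hurewicz_of_cancel`
being discharged by `hurewicz_subsingleton_holds`. [cite: Kosinski1993, Ch. VI §1 (remark before Cor. 1.4)] [cite: Matsumoto2001, proof of Thm. 3.35] -/
theorem contractibleSpace_compl_image_ball_of_cancel
    (hK : exists_isMorse_ncard_criticalSetOfIndex_zero_add_one_eq.{0} 2) :
    contractibleSpace_compl_image_ball :=
  contractibleSpace_compl_image_ball_of_hurewicz_of_cancel
    Literature.AlgebraicTopology.SingularHomology.hurewicz_subsingleton_holds hK

/-- **The target fact from spc4.S24 (b) in dimension `2`** (`exists_isMorse_isSelfIndexing 2`,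
Milnor 1965, Thm. 4.8 with §8). [cite: Kosinski1993, Ch. VI §1 (remark before Cor. 1.4)] [cite: MilnorHCobordism1965, Thm. 4.8 and §8] -/
theorem contractibleSpace_compl_image_ball_of_exists_isSelfIndexing
    (hS : FourManifolds.exists_isMorse_isSelfIndexing.{0} 2) : contractibleSpace_compl_image_ball :=
  contractibleSpace_compl_image_ball_of_niceMorse (exists_isMorse_ncard_criticalSetOfIndex_eq_one_of_SPC4 2 hS)

/-- **The target fact from Milnor's First Cancellation Theorem 5.4 on a slab**
(`Cobordism.Milnor1965_firstCancellation_slab`). [cite: Kosinski1993, Ch. VI §1 (remark before Cor. 1.4)] [cite: MilnorHCobordism1965, Thm. 5.4] -/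
theorem contractibleSpace_compl_image_ball_of_firstCancellation_slab
    (h54 : Cobordism.Milnor1965_firstCancellation_slab.{0}) : contractibleSpace_compl_image_ball :=
  contractibleSpace_compl_image_ball_of_exists_isSelfIndexing
    (exists_isMorse_isSelfIndexing_of_firstCancellation_slab h54 2)

/-- **The target fact from Assertion 6 of the proof of Milnor's Thm. 5.4**
(`Cobordism.Milnor1965_cancellation_modelChart`). [cite: Kosinski1993, Ch. VI §1 (remark before Cor. 1.4)] [cite: MilnorHCobordism1965, proof of Thm. 5.4, Assertion 6] -/
theorem contractibleSpace_compl_image_ball_of_modelChart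
    (hE : Cobordism.Milnor1965_cancellation_modelChart.{0}) : contractibleSpace_compl_image_ball :=
  contractibleSpace_compl_image_ball_of_exists_isSelfIndexing (exists_isMorse_isSelfIndexing_of_modelChart hE 2)

/-- **The target fact from `Θ₂ = 0` alone** (`nonemptyDiffeomorphSphere_two`, Kervaire–Milnor
1963, p. 507): the Hurewicz leaf of `contractibleSpace_compl_image_ball_of_hurewicz_of_two`
(`HomotopySpheresSumENR.lean`) is discharged by `hurewicz_subsingleton_holds`. [cite: Kosinski1993, Ch. VI §1 (remark before Cor. 1.4)] [cite: KervaireMilnorAnnals1963, §2 p. 507] -/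
theorem contractibleSpace_compl_image_ball_of_sphere_two (h2 : nonemptyDiffeomorphSphere_two.{0}) :
    contractibleSpace_compl_image_ball :=
  contractibleSpace_compl_image_ball_of_hurewicz_of_two
    Literature.AlgebraicTopology.SingularHomology.hurewicz_subsingleton_holds h2

/-- **The target fact from the general case of Assertion 6 of the proof of Milnor's Thm. 5.4**
(`Cobordism.Milnor1965_cancellation_levelIsotopy`, PDF pp. 31–32): the aligned charts and the
gluing under the supposition are theorems of the tree
(`Cobordism.Milnor1965_cancellation_alignedCharts_holds`,
`Cobordism.Milnor1965_cancellation_glueCharts_holds`), assembled by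
`Cobordism.Milnor1965_cancellation_modelChart_of_parts`. [cite: Kosinski1993, Ch. VI §1 (remark before Cor. 1.4)] [cite: MilnorHCobordism1965, proof of Thm. 5.4, Assertion 6 (PDF pp. 31–32)] -/
theorem contractibleSpace_compl_image_ball_of_levelIsotopy
    (hI : Cobordism.Milnor1965_cancellation_levelIsotopy.{0}) : contractibleSpace_compl_image_ball :=
  contractibleSpace_compl_image_ball_of_modelChart
    (Cobordism.Milnor1965_cancellation_modelChart_of_parts
      Cobordism.Milnor1965_cancellation_alignedCharts_holds hI
      Cobordism.Milnor1965_cancellation_glueCharts_holds)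

/-- **The target fact from the deformation of the level diffeomorphism `h` alone**
(`Cobordism.Milnor1965_cancellation_levelDeformation`: Milnor 1965, proof of Thm. 5.4,
Assertion 6, PDF pp. 31–32, with the local Theorem 5.6), through Lemma 4.7
(`Cobordism.Milnor1965_cancellation_levelIsotopy_of_deformation`, `HCobordismLevelIsotopy.lean`).
This is the single remaining leaf of `contractibleSpace_compl_image_ball`. [cite: Kosinski1993, Ch. VI §1 (remark before Cor. 1.4)] [cite: MilnorHCobordism1965, proof of Thm. 5.4, Assertion 6 (PDF pp. 31–32) and Thm. 5.6 (PDF p. 32)] -/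
theorem contractibleSpace_compl_image_ball_of_levelDeformation
    (hD : Cobordism.Milnor1965_cancellation_levelDeformation.{0}) :
    contractibleSpace_compl_image_ball :=
  contractibleSpace_compl_image_ball_of_levelIsotopy
    (Cobordism.Milnor1965_cancellation_levelIsotopy_of_deformation hD)

/-- **The sum of two homotopy spheres is a homotopy sphere** (Kervaire–Milnor 1963, §2, p. 505;
the tree's fact `HomotopySphere.nonempty_homotopyEquiv_sphere_of_isConnectedSum`, all `n`) from
Matsumoto's Thm. 3.35 in dimension `2` alone. [cite: KervaireMilnorAnnals1963, §2 (p. 505)] [cite: Matsumoto2001, Thm. 3.35] -/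
theorem nonempty_homotopyEquiv_sphere_of_isConnectedSum_of_niceMorse
    (hU : exists_isMorse_ncard_criticalSetOfIndex_eq_one.{0} 2) :
    nonempty_homotopyEquiv_sphere_of_isConnectedSum :=
  nonempty_homotopyEquiv_sphere_of_isConnectedSum_of (contractibleSpace_compl_image_ball_of_niceMorse hU)

end HomotopySphere

end Literature.Topology.FourManifolds

end
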